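import Mathlib.MeasureTheory.Measure.Haar.Basic
import Literature.NumberTheory.Automorphic.IwahoriDoubleCosetIndex
import Literature.NumberTheory.Automorphic.CompactOpenIndexHaar
import Literature.NumberTheory.Automorphic.HeckeOperatorAdjoint
import HarnessLib

/-!
# Haar volume of a double coset: `μ(K b K) = [K : K ∩ bKb⁻¹] · μ(K)`, the lower bound `μ(K) · δ_P(b)⁻¹ ≤ μ(K b K)` through the Haar
# measure of the radical, and the ray form `μ(K) · δ_P(a)⁻ᵐ ≤ μ(K aᵐ K)` (Casselman 1995, Lemma 1.5.1; Bruhat–Tits 1972, (4.4.4))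

Topic `NumberTheory/Automorphic`; namespace `Literature.NumberTheory.Automorphic.DoubleCosetIndex` (continues ★ `IwahoriDoubleCosetIndex` p832359 and ★
`CompactOpenIndexHaar`).  THEOREMS ONLY (no definition, no named fact, no instance, no notation, no `sorry`).  Cell `hodgecm-mathlib`, F0∕P3
«U3-mult», N5 road (Casselman's square-integrability criterion ★ `UnitaryGroup.U3SquareIntegrableExponents` [Casselman1995, Thm. 4.4.6]), file
(R3c) of the GROUP∕MEASURE half (seat B-p04 (g31)).  It delivers, for a locally compact group `G` with a Haar measure `μG`, a compact open
subgroup `K`, a closed subgroup `N` (the radical) with a Haar measure `μN`, and an element `b` (resp. a ray `aᵐ`) with `b^{±1} N b^{∓1} ⊆ N`,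
`b (K ∩ N) b⁻¹ ⊆ K` and `μN.map (n ↦ b n b⁻¹) = c • μN` (the modulus, ★ `map_torusConj_cmBorel_eq_modularCharacter_nnreal_smul`:
`c = Δ_P(b⁻¹) = δ_P(b)⁻¹`):
* §1 **`measure_doubleCoset_eq_relIndex_mul`**: `μG(K b K) = [K : K ∩ bKb⁻¹] · μG(K)` (★ `measure_doubleCoset_eq_ncard_mul`
  (`HeckeOperatorAdjoint`: `μ(KgK) = #(KgK∕K)·μ(K)`) + ★ `ncard_orbit_eq_relIndex`; finiteness of the index from compactness,
  `relIndex_conj_smul_ne_zero`).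
* §2 **`relIndex_conj_smul_inf_eq_of_map_conj`**: `([K ∩ N : b(K ∩ N)b⁻¹] : ℝ≥0∞) = c` — ★ `relIndex_eq_of_map_eq_smul` inside the group `↥N`
  (the compact open `K ∩ N` of `N`, the conjugation `ψ`, `ψ(K ∩ N) = b(K ∩ N)b⁻¹`); **`smul_measure_le_measure_doubleCoset`**:
  `c · μG(K) ≤ μG(K b K)` — NO factorisation of `K` (★ `relIndex_conj_le_of_contracts`).  This is the ⇒-half volume growth of
  [Casselman1995, Thm. 4.4.6]: `meas(K aᵐ K) ≥ δ_P(a)⁻ᵐ meas(K)`.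
* §3 the RAY form consumed by the «⇒» brick (F0P3a-p04's `hvolG`): **`measureReal_mul_inv_pow_le_measureReal_doubleCoset_pow`** — for
  `a` with `a^{±1} N a^{∓1} ⊆ N`, `a (K ∩ N) a⁻¹ ⊆ K`, conjugations `ψ m` (`(ψ m n : G) = aᵐ n a⁻ᵐ`) with `μN.map (ψ m) = (d⁻¹)ᵐ • μN`:
  `∀ m, μG.real K * (d : ℝ)⁻¹ ^ m ≤ μG.real (K aᵐ K)`.
[Casselman1995, §1.5 Lemma 1.5.1 p. 16: «meas K₀aK₀ = δ_P⁻¹(a) meas K₀ … [K₀ : K₀ ∩ aK₀a⁻¹] = [N₀ : aN₀a⁻¹] = δ_P⁻¹(a)»; the inequality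
half needs no Iwahori factorisation.]

## References
* [Casselman1995] W. Casselman, *Introduction to the theory of admissible representations of `p`-adic reductive groups* (draft 1 May 1995),
  §1.5 Lemma 1.5.1 p. 16, Prop. 1.4.4 p. 14, Thm. 4.4.6 p. 45.
* [BruhatTits1972] F. Bruhat, J. Tits, *Groupes réductifs sur un corps local I*, Publ. Math. IHÉS 41 (1972), (4.4.4).
* [CartierCorvallis1979] P. Cartier, *Representations of 𝔭-adic groups: a survey*, PSPM 33.1 (1979), §IV.1.
-/

set_option autoImplicit false

open scoped Pointwise ENNReal NNReal
open MeasureTheory MulAction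

namespace Literature.NumberTheory.Automorphic

namespace DoubleCosetIndex

variable {G : Type*} [Group G]

/-- `x ∈ bKb⁻¹ ↔ b⁻¹ x b ∈ K` (private bookkeeping copy). [folklore] -/
private theorem mem_conj_smul_iff' (K : Subgroup G) (b x : G) : x ∈ ConjAct.toConjAct b • K ↔ b⁻¹ * x * b ∈ K := by
  rw [Subgroup.mem_pointwise_smul_iff_inv_smul_mem, ← map_inv, ConjAct.toConjAct_smul, inv_inv]

/-! ## §1 `μG(K b K) = #(KbK ∕ K) · μG(K) = [K : K ∩ bKb⁻¹] · μG(K)` -/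

variable [TopologicalSpace G] [IsTopologicalGroup G] [MeasurableSpace G] [BorelSpace G]

omit [MeasurableSpace G] [BorelSpace G] in
/-- `bKb⁻¹` is open for `K` open. [cite: CartierCorvallis1979, §IV.1] -/
theorem isOpen_conj_smul {K : Subgroup G} (hKo : IsOpen (K : Set G)) (b : G) :
    IsOpen ((ConjAct.toConjAct b • K : Subgroup G) : Set G) := by
  have hset : ((ConjAct.toConjAct b • K : Subgroup G) : Set G) = (fun x : G => b⁻¹ * x * b) ⁻¹' (K : Set G) := by
    ext x; exact mem_conj_smul_iff' K b x
  rw [hset]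
  exact hKo.preimage ((continuous_const.mul continuous_id).mul continuous_const)

/-- **`[K : K ∩ bKb⁻¹] < ∞`** for `K` compact open in a locally compact group (an open subgroup of a compact group has finite index; read off
a Haar measure via ★ `relIndex_ne_zero_of_measure`). [cite: Casselman1995, §1.5 Lemma 1.5.1 p. 16] -/
theorem relIndex_conj_smul_ne_zero (μG : Measure G) [μG.IsHaarMeasure] {K : Subgroup G} (hKo : IsOpen (K : Set G))
    (hKc : IsCompact (K : Set G)) (b : G) : (ConjAct.toConjAct b • K).relIndex K ≠ 0 := by
  rw [← relIndex_inf_conj_smul]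
  have hVo : IsOpen ((K ⊓ ConjAct.toConjAct b • K : Subgroup G) : Set G) := by
    rw [Subgroup.coe_inf]; exact hKo.inter (isOpen_conj_smul hKo b)
  exact relIndex_ne_zero_of_measure μG inf_le_left hVo.measurableSet
    (hVo.measure_pos μG ⟨1, (K ⊓ ConjAct.toConjAct b • K).one_mem⟩).ne' hKc.measure_lt_top.ne

/-- **`μG(K b K) = [K : K ∩ bKb⁻¹] · μG(K)`** (`K` compact open, `μG` a Haar measure): Casselman's Lemma 1.5.1, first equality («the map
`k₁ a k₂ ↦ k₁` induces an isomorphism between `K₀aK₀ ∕ K₀` and `K₀ ∕ (K₀ ∩ aK₀a⁻¹)»; ★ `measure_doubleCoset_eq_ncard_mul` + ★ `ncard_orbit_eq_relIndex`).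
[cite: Casselman1995, §1.5 Lemma 1.5.1 p. 16]
[cite: CartierCorvallis1979, §IV.1] -/
theorem measure_doubleCoset_eq_relIndex_mul (μG : Measure G) [μG.IsHaarMeasure] {K : Subgroup G} (hKo : IsOpen (K : Set G))
    (hKc : IsCompact (K : Set G)) (b : G) :
    μG (DoubleCoset.doubleCoset b (K : Set G) K) = (ConjAct.toConjAct b • K).relIndex K * μG K := by
  have hne : (orbit K ((b : G) : G ⧸ K)).ncard ≠ 0 := by
    rw [ncard_orbit_eq_relIndex]; exact relIndex_conj_smul_ne_zero μG hKo hKc b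
  rw [measure_doubleCoset_eq_ncard_mul K μG hKo b (Set.finite_of_ncard_ne_zero hne), ncard_orbit_eq_relIndex]

omit [MeasurableSpace G] [BorelSpace G] in
/-- `K b K` is compact for `K` compact. [cite: CartierCorvallis1979, §IV.1] -/
theorem isCompact_doubleCoset {K : Subgroup G} (hKc : IsCompact (K : Set G)) (b : G) :
    IsCompact (DoubleCoset.doubleCoset b (K : Set G) K) :=
  (hKc.mul isCompact_singleton).mul hKc

/-! ## §2 The radical's Haar measure: `[K ∩ N : b(K ∩ N)b⁻¹] = c` and `c · μG(K) ≤ μG(K b K)` -/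

section Radical

variable {K N : Subgroup G}

omit [TopologicalSpace G] [IsTopologicalGroup G] [MeasurableSpace G] [BorelSpace G] in
/-- Powers-free bookkeeping: `b(K ∩ N)b⁻¹ ≤ K ∩ N` when `b(K ∩ N)b⁻¹ ⊆ K` and `bNb⁻¹ ⊆ N`. [cite: Casselman1995, Prop. 1.4.4] -/
theorem conj_smul_inf_le {b : G} (hbKN : ∀ n ∈ K ⊓ N, b * n * b⁻¹ ∈ K) (hbN' : ∀ n ∈ N, b * n * b⁻¹ ∈ N) :
    ConjAct.toConjAct b • (K ⊓ N) ≤ K ⊓ N := by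
  intro x hx
  rw [mem_conj_smul_iff'] at hx
  have hx' : x = b * (b⁻¹ * x * b) * b⁻¹ := by group
  rw [hx']
  exact Subgroup.mem_inf.2 ⟨hbKN _ hx, hbN' _ (Subgroup.mem_inf.1 hx).2⟩

omit [MeasurableSpace G] [BorelSpace G] in
/-- **`[K ∩ N : b(K ∩ N)b⁻¹] = c` when `μN.map (n ↦ b n b⁻¹) = c • μN`** on the closed subgroup `N` (`μN` a Haar measure of `↥N`), for
`K` compact open with `b(K ∩ N)b⁻¹ ⊆ K`, `b^{±1} N b^{∓1} ⊆ N`: ★ `relIndex_eq_of_map_eq_smul` in the group `↥N` with `U = K ∩ N` (compact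
open in `N`) and `ψ(U) = b(K ∩ N)b⁻¹`.  With `c = Δ_P(b⁻¹) = δ_P(b)⁻¹` (★ `map_torusConj_cmBorel_eq_modularCharacter_nnreal_smul` at
`t = b⁻¹`) this is Casselman's «`[N₀ : aN₀a⁻¹] = δ_P⁻¹(a)`». [cite: Casselman1995, §1.5 Lemma 1.5.1 p. 16] [cite: BruhatTits1972, (4.4.4)] -/
theorem relIndex_conj_smul_inf_eq_of_map_conj (hKo : IsOpen (K : Set G)) (hKc : IsCompact (K : Set G))
    (hNc : IsClosed (N : Set G)) [MeasurableSpace ↥N] [BorelSpace ↥N] (μN : Measure ↥N) [μN.IsHaarMeasure] {b : G}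
    (hbKN : ∀ n ∈ K ⊓ N, b * n * b⁻¹ ∈ K) (hbN : ∀ n ∈ N, b⁻¹ * n * b ∈ N) (hbN' : ∀ n ∈ N, b * n * b⁻¹ ∈ N)
    (ψ : ↥N → ↥N) (hψ : ∀ n : ↥N, ((ψ n : ↥N) : G) = b * n * b⁻¹) {c : ℝ≥0∞} (hμN : μN.map ψ = c • μN) :
    ((ConjAct.toConjAct b • (K ⊓ N)).relIndex (K ⊓ N) : ℝ≥0∞) = c := by
  -- the subgroups of `↥N`
  set U : Subgroup ↥N := K.comap N.subtype with hU
  set V : Subgroup ↥N := (ConjAct.toConjAct b • (K ⊓ N)).comap N.subtype with hV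
  -- index transfer along `N ↪ G`
  have hidx : V.relIndex U = (ConjAct.toConjAct b • (K ⊓ N)).relIndex (K ⊓ N) := by
    rw [hV, hU, Subgroup.relIndex_comap, Subgroup.map_comap_eq, Subgroup.range_subtype, inf_comm]
  rw [← hidx]
  -- continuity ∕ measurability ∕ injectivity of `ψ`
  have hψc : Continuous ψ := by
    refine continuous_induced_rng.2 ?_
    have : (Subtype.val ∘ ψ) = fun n : ↥N => b * (n : G) * b⁻¹ := funext hψ
    rw [this]
    exact (continuous_const.mul continuous_subtype_val).mul continuous_const
  have hinj : Function.Injective ψ := by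
    intro x y hxy
    have h := congrArg (fun z : ↥N => (z : G)) hxy
    simp only [hψ] at h
    exact Subtype.ext (mul_left_cancel (mul_right_cancel h))
  -- `V ≤ U`, `V = ψ '' U`
  have hVU : V ≤ U := by
    intro x hx
    have hx' : (x : G) ∈ ConjAct.toConjAct b • (K ⊓ N) := hx
    exact (Subgroup.mem_inf.1 (conj_smul_inf_le hbKN hbN' hx')).1
  have hVψ : (V : Set ↥N) = ψ '' (U : Set ↥N) := by
    ext y
    constructor
    · intro hy
      have hy' : b⁻¹ * (y : G) * b ∈ K ⊓ N := (mem_conj_smul_iff' _ _ _).1 hy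
      refine ⟨⟨b⁻¹ * (y : G) * b, (Subgroup.mem_inf.1 hy').2⟩, (Subgroup.mem_inf.1 hy').1, Subtype.ext ?_⟩
      rw [hψ]; group
    · rintro ⟨x, hx, rfl⟩
      change ((ψ x : ↥N) : G) ∈ ConjAct.toConjAct b • (K ⊓ N)
      rw [hψ, mem_conj_smul_iff']
      have : b⁻¹ * (b * (x : G) * b⁻¹) * b = x := by group
      rw [this]
      exact Subgroup.mem_inf.2 ⟨hx, x.2⟩
  -- `V` is open (hence measurable, of positive measure), `U` is compact (hence of finite measure)
  have hVo : IsOpen (V : Set ↥N) := by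
    have hset : (V : Set ↥N) = (fun n : ↥N => b⁻¹ * (n : G) * b) ⁻¹' (K : Set G) := by
      ext y
      change (y : G) ∈ ConjAct.toConjAct b • (K ⊓ N) ↔ b⁻¹ * (y : G) * b ∈ K
      rw [mem_conj_smul_iff']
      exact ⟨fun h => (Subgroup.mem_inf.1 h).1, fun h => Subgroup.mem_inf.2 ⟨h, hbN _ y.2⟩⟩
    rw [hset]
    exact hKo.preimage ((continuous_const.mul continuous_subtype_val).mul continuous_const)
  have hUc : IsCompact (U : Set ↥N) := hNc.isClosedEmbedding_subtypeVal.isCompact_preimage hKc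
  have hV0 : μN V ≠ 0 := (hVo.measure_pos μN ⟨1, V.one_mem⟩).ne'
  exact relIndex_eq_of_map_eq_smul μN hψc.measurable hinj hμN hVU hVψ hVo.measurableSet hV0 hUc.measure_lt_top.ne

/-- **`c · μG(K) ≤ μG(K b K)`** — the volume growth WITHOUT Iwahori factorisation: `μG(KbK) = [K : K ∩ bKb⁻¹] μG(K)` (§1),
`[K : K ∩ bKb⁻¹] ≥ [K ∩ N : b(K ∩ N)b⁻¹]` (★ `relIndex_conj_le_of_contracts`), `= c` (above).  With `c = δ_P(b)⁻¹`:
`meas(K aᵐ K) ≥ δ_P(a)⁻ᵐ meas(K)`, the lower bound behind the ⇒ half of [Casselman1995, Thm. 4.4.6]. [cite: Casselman1995, §1.5 Lemma 1.5.1 p. 16, Thm. 4.4.6]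
[cite: BruhatTits1972, (4.4.4)] -/
theorem smul_measure_le_measure_doubleCoset (μG : Measure G) [μG.IsHaarMeasure] (hKo : IsOpen (K : Set G))
    (hKc : IsCompact (K : Set G)) (hNc : IsClosed (N : Set G)) [MeasurableSpace ↥N] [BorelSpace ↥N] (μN : Measure ↥N)
    [μN.IsHaarMeasure] {b : G} (hbKN : ∀ n ∈ K ⊓ N, b * n * b⁻¹ ∈ K) (hbN : ∀ n ∈ N, b⁻¹ * n * b ∈ N)
    (hbN' : ∀ n ∈ N, b * n * b⁻¹ ∈ N) (ψ : ↥N → ↥N) (hψ : ∀ n : ↥N, ((ψ n : ↥N) : G) = b * n * b⁻¹) {c : ℝ≥0∞}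
    (hμN : μN.map ψ = c • μN) :
    c * μG K ≤ μG (DoubleCoset.doubleCoset b (K : Set G) K) := by
  rw [measure_doubleCoset_eq_relIndex_mul μG hKo hKc b, ← relIndex_conj_smul_inf_eq_of_map_conj hKo hKc hNc μN hbKN hbN hbN' ψ hψ hμN]
  gcongr
  exact_mod_cast relIndex_conj_le_of_contracts K N hbN hbN' hbKN (relIndex_conj_smul_ne_zero μG hKo hKc b)

end Radical

/-! ## §3 The ray form: `μG.real K · d⁻¹ ^ m ≤ μG.real (K aᵐ K)` -/

section Ray

variable {K N : Subgroup G} {a : G}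

omit [TopologicalSpace G] [IsTopologicalGroup G] [MeasurableSpace G] [BorelSpace G] in
/-- Powers inherit `a⁻¹ N a ⊆ N`. [cite: Casselman1995, Prop. 1.4.3] -/
theorem forall_pow_inv_mul_mul_pow_mem_of_forall (haN : ∀ n ∈ N, a⁻¹ * n * a ∈ N) (m : ℕ) :
    ∀ n ∈ N, (a ^ m)⁻¹ * n * a ^ m ∈ N := by
  induction m with
  | zero => intro n hn; simpa using hn
  | succ m ih =>
    intro n hn
    have h := haN _ (ih n hn)
    have heq : a⁻¹ * ((a ^ m)⁻¹ * n * a ^ m) * a = (a ^ (m + 1))⁻¹ * n * a ^ (m + 1) := by rw [pow_succ]; group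
    rwa [heq] at h

omit [TopologicalSpace G] [IsTopologicalGroup G] [MeasurableSpace G] [BorelSpace G] in
/-- Powers inherit `a N a⁻¹ ⊆ N`. [cite: Casselman1995, Prop. 1.4.3] -/
theorem forall_pow_mul_mul_pow_inv_mem_of_forall (haN' : ∀ n ∈ N, a * n * a⁻¹ ∈ N) (m : ℕ) :
    ∀ n ∈ N, a ^ m * n * (a ^ m)⁻¹ ∈ N := by
  induction m with
  | zero => intro n hn; simpa using hn
  | succ m ih =>
    intro n hn
    have h := ih _ (haN' n hn)
    have heq : a ^ m * (a * n * a⁻¹) * (a ^ m)⁻¹ = a ^ (m + 1) * n * (a ^ (m + 1))⁻¹ := by rw [pow_succ']; group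
    rwa [heq] at h

omit [TopologicalSpace G] [IsTopologicalGroup G] [MeasurableSpace G] [BorelSpace G] in
/-- Powers inherit the contraction `a(K ∩ N)a⁻¹ ⊆ K` (given `aNa⁻¹ ⊆ N`). [cite: Casselman1995, Prop. 1.4.3] -/
theorem forall_pow_mul_mul_pow_inv_mem_K_of_forall (haKN : ∀ n ∈ K ⊓ N, a * n * a⁻¹ ∈ K) (haN' : ∀ n ∈ N, a * n * a⁻¹ ∈ N)
    (m : ℕ) : ∀ n ∈ K ⊓ N, a ^ m * n * (a ^ m)⁻¹ ∈ K := by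
  induction m with
  | zero => intro n hn; simpa using (Subgroup.mem_inf.1 hn).1
  | succ m ih =>
    intro n hn
    have hn' : a * n * a⁻¹ ∈ K ⊓ N := Subgroup.mem_inf.2 ⟨haKN n hn, haN' n (Subgroup.mem_inf.1 hn).2⟩
    have h := ih _ hn'
    have heq : a ^ m * (a * n * a⁻¹) * (a ^ m)⁻¹ = a ^ (m + 1) * n * (a ^ (m + 1))⁻¹ := by rw [pow_succ']; group
    rwa [heq] at h

/-- **The ray volume bound `μG.real K · d⁻¹ ^ m ≤ μG.real (K aᵐ K)`** (the «⇒»-brick's `hvolG` with `c₀ = μG.real K`): `a` with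
`a^{±1} N a^{∓1} ⊆ N`, `a(K ∩ N)a⁻¹ ⊆ K`, and the radical's Haar measure scaled by the conjugations `ψ m` (`(ψ m n : G) = aᵐ n a⁻ᵐ`) as
`μN.map (ψ m) = (d⁻¹)ᵐ • μN` — in the application `d = δ_P(a) = Δ_P(a)` and `ψ m = torusConj (aᵐ)⁻¹` (★
`map_torusConj_cmBorel_eq_modularCharacter_nnreal_smul`, `Δ_P((aᵐ)⁻¹) = Δ_P(a)⁻ᵐ`).  NO Iwahori factorisation of `K` is needed on this side.
[cite: Casselman1995, §1.5 Lemma 1.5.1 p. 16, Thm. 4.4.6 p. 45] [cite: BruhatTits1972, (4.4.4)] -/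
theorem measureReal_mul_inv_pow_le_measureReal_doubleCoset_pow (μG : Measure G) [μG.IsHaarMeasure] (hKo : IsOpen (K : Set G))
    (hKc : IsCompact (K : Set G)) (hNc : IsClosed (N : Set G)) [MeasurableSpace ↥N] [BorelSpace ↥N] (μN : Measure ↥N)
    [μN.IsHaarMeasure] (haKN : ∀ n ∈ K ⊓ N, a * n * a⁻¹ ∈ K) (haN : ∀ n ∈ N, a⁻¹ * n * a ∈ N)
    (haN' : ∀ n ∈ N, a * n * a⁻¹ ∈ N) (ψ : ℕ → ↥N → ↥N) (hψ : ∀ (m : ℕ) (n : ↥N), ((ψ m n : ↥N) : G) = a ^ m * n * (a ^ m)⁻¹)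
    {d : ℝ≥0} (hμN : ∀ m : ℕ, μN.map (ψ m) = ((d⁻¹ ^ m : ℝ≥0) : ℝ≥0∞) • μN) (m : ℕ) :
    μG.real K * (d : ℝ)⁻¹ ^ m ≤ μG.real (DoubleCoset.doubleCoset (a ^ m) (K : Set G) K) := by
  have h := smul_measure_le_measure_doubleCoset μG hKo hKc hNc μN (b := a ^ m)
    (forall_pow_mul_mul_pow_inv_mem_K_of_forall haKN haN' m) (forall_pow_inv_mul_mul_pow_mem_of_forall haN m)
    (forall_pow_mul_mul_pow_inv_mem_of_forall haN' m) (ψ m) (hψ m) (hμN m)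
  have hfin : μG (DoubleCoset.doubleCoset (a ^ m) (K : Set G) K) ≠ ∞ := (isCompact_doubleCoset hKc _).measure_lt_top.ne
  have h' := (ENNReal.toReal_le_toReal (by exact ENNReal.mul_ne_top ENNReal.coe_ne_top hKc.measure_lt_top.ne) hfin).2 h
  rw [ENNReal.toReal_mul] at h'
  have hd : (((d⁻¹ ^ m : ℝ≥0) : ℝ≥0∞)).toReal = (d : ℝ)⁻¹ ^ m := by
    rw [ENNReal.coe_toReal, NNReal.coe_pow, NNReal.coe_inv]
  rw [hd] at h'
  rw [measureReal_def, measureReal_def, mul_comm]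
  exact h'

end Ray

end DoubleCosetIndex

end Literature.NumberTheory.Automorphic
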